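import Summits.QuantumFields.BalabanUV.Beta.GAN24.KSlotAssembly
import Summits.QuantumFields.BalabanUV.Beta.GAN24.StencilSlotCauchyOfShapes

/-!
# `BalabanUV.Beta.GAN24.StencilSlotOfE3` — binder row G-an2-4 / (CONV-C), `d = 3`: with the K-slot LANDED (`KSlotAssembly.convCKWall_holds`,
# p204341) the wall's STENCIL binders `(hS, hSall)` are functions of the located third-jet shapes «E3Shape» ∧ «E3Drift» ALONE

NOT IN PRINT; OUR PROOF ATTEMPT (row owner b2b-balaban-gan24-p1, gen 3).  HONEST FRAMING (cell contract, verbatim): «discharging `BetaPertH`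
makes Bałaban's UV stability UNCONDITIONAL — a real constructive-QFT result; it is NOT the continuum limit and NOT the Clay problem.»
HONEST DEPENDENCY (verbatim): «continuum YM on T⁴ ⇐ BetaPertH ∧ nine spine estimates (0/9 proved); BetaPertH ⇐ (D1) ∧ (D4) ∧ CAP+tail;
G-an2-4 gates asym, D1 and NE2/3/4.»  [folklore] composition BY NAME of road P1's END `KSlotAssembly.convCKWall_holds` (carver + the G-an2-4
formalisation swarm) with this lineage's S-slot ENDs `StencilSlotOfShapes.hS_of_shapes` / `StencilSlotCauchyOfShapes.hSall_of_shapes`, plus the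
monotonicity of the Cauchy datum in its rate parameter `θ` (to merge the K-slot's `θ_K ∈ [0,1)` with the located drift's `θ₃ ∈ (0,1)` at
`max θ_K θ₃`); no estimate, no cited fact, no `def`, no `Prop` mirror.  The located shapes «E3Shape»/«E3Drift» (the `j`-uniform bi-localisation
and the geometric drift of the NORMALISED VALUE-FUNCTION THIRD JET `e3Of` of an2's composites — NOT IN PRINT for the typed objects; design
note `HOME/b2b-balaban-gan24-p1/SKELETON-S3.md`) are INLINE HYPOTHESES, asserted nowhere.  NOTHING of the wall is discharged: `(hS, hSall)` are
concluded FROM open hypotheses; `(hW, hWall)`, the window radii and the identification are untouched.  NOT summit progress.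

## What is proved (`d = 3`, every blocking factor `Lc ≥ 2`; units `sfStep Lc`, `smStep 3 Lc` BY NAME)
* `cauchyDecayK_mono_theta`, `unitDecayK_of_convCKWall`-style unpacking: the K-slot supplies `UnitDecayK 3 Lc … C δ` (`0 < δ`) and, for any
  `θ′ ∈ [θ_K, 1)`, `CauchyDecayK 3 Lc … cK θ′ δ`.
* **`hS_of_e3`**: «E3Shape» (`hE3`, `0 < δ₃`) ⟹ `∃ Cs δS, 0 < δS ∧ ∀ j, LocStencil (unitS (sfStep Lc j) (smStep 3 Lc j) (JsBal0Of … j).S) Cs δS` (= `hS`).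
* **`hSall_of_e3`**: «E3Shape» ∧ «E3Drift at rate θ₃» (`0 < θ₃ < 1`) ⟹ `∃ cS θ δS, 0 ≤ θ ∧ θ < 1 ∧ 0 < δS ∧ ∀ k j, LocStencil (unitS_{k+j} (JsBal0Of … (k+j)).S −
  unitS_k (JsBal0Of … k).S) (cS·θ^k) δS` (= `hSall` with its rate data, `θ = max θ_K θ₃`).
So for `d = 3`, `Lc ≥ 2`: **(hS, hSall) ⇐ «E3Shape» ∧ «E3Drift»** in the kernel — the S-slot's located analytic content is that statement pair and nothing else.
-/

noncomputable section

open Literature.MathematicalPhysics.QuantumFieldTheory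
open Literature.MathematicalPhysics.QuantumFieldTheory.Balaban1983to89
open Literature.MathematicalPhysics.QuantumFieldTheory.Balaban1983to89.Beta
open ExpKernelCalculus (MKer Decays VertexFamily₂)
open OneStepResolventKernel (Fib LocStencil decays_mono)
open StepJetData (mfNeg)
open BalabanStepJetsSucc (wE e3Of JsBal0Of)
open Summit.QuantumFields.BalabanUV.Beta.HessKerDressedUnits (unitS)
open Summit.QuantumFields.BalabanUV.Beta.GAN24.CombesThomas (sfStep smStep KStepUnit UnitDecayK CauchyDecayK ConvCKWall)
open Summit.QuantumFields.BalabanUV.Beta.GAN24.KSlotAssembly (convCKWall_holds)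
open Summit.QuantumFields.BalabanUV.Beta.GAN24.StencilSlotOfShapes (hS_of_shapes)
open Summit.QuantumFields.BalabanUV.Beta.GAN24.StencilSlotCauchyOfShapes (hSall_of_shapes)

namespace Summit.QuantumFields.BalabanUV.Beta.GAN24.StencilSlotOfE3

variable {d : ℕ} {Lc : ℕ} [NeZero Lc]

/-! ## §1 The Cauchy datum is monotone in its rate parameter -/

/-- [folklore] `CauchyDecayK … cK θ δ → θ ≤ θ′ → 0 ≤ θ → CauchyDecayK … cK θ′ δ` (the constants `cK θ^k` only grow). -/
theorem cauchyDecayK_mono_theta {sf sm : ℕ → ℝ} {cK θ θ' δ : ℝ} (h : CauchyDecayK d Lc sf sm cK θ δ) (hθ : 0 ≤ θ) (hθθ : θ ≤ θ') :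
    CauchyDecayK d Lc sf sm cK θ' δ := by
  have hcK : 0 ≤ cK := by
    have h0 := (h 0 0).nonneg (Sum.inl 0)
    simpa using h0
  intro k j
  exact decays_mono (h k j) (mul_nonneg hcK (pow_nonneg hθ k))
    (mul_le_mul_of_nonneg_left (pow_le_pow_left₀ hθ hθθ k) hcK) le_rfl

/-! ## §2 `d = 3`: the stencil binders from the located third-jet shapes alone -/

omit [NeZero Lc] in
/-- [folklore] `2 ≤ Lc → 1 ≤ Lc`. -/
theorem one_le_of_two_le (hLc : 2 ≤ Lc) : 1 ≤ Lc := le_trans (by norm_num) hLc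

/-- **`hS` FROM «E3Shape» ALONE** (`d = 3`, `Lc ≥ 2`): the K-slot's decay half is `KSlotAssembly.convCKWall_holds`, so the uniform S-binder of the
wall is a function of the located shape only. -/
theorem hS_of_e3 (hLc : 2 ≤ Lc) {cE cVH cΛ C₃ δ₃ : ℝ}
    (hE3 : ∀ j : ℕ, LocStencil (unitS (sfStep Lc (j + 1)) (smStep 3 Lc (j + 1))
      (fun κ u => (cE * wE 3 Lc (j + 1)) • e3Of 3 Lc cE cVH cΛ (j + 1) κ u)) C₃ δ₃) (hδ₃ : 0 < δ₃)
    (W : ℕ → Fin (3 + 1) → (Fin (3 + 1) → ℤ) → Fin (3 + 1) → (Fin (3 + 1) → ℤ) → MKer (3 + 1) (Fib 3))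
    (Cw δw : ℕ → ℝ) (hδw : ∀ j, 0 < δw j) (hW : ∀ j, VertexFamily₂ (W j) Lc (Cw j) (δw j)) :
    ∃ Cs δS : ℝ, 0 < δS ∧ ∀ j, LocStencil (unitS (sfStep Lc j) (smStep 3 Lc j)
      (JsBal0Of (one_le_of_two_le hLc) cE cVH cΛ W Cw δw hδw hW j).S) Cs δS := by
  obtain ⟨C, δ, cK, θ, hδ, -, -, hK, -⟩ := convCKWall_holds (Lc := Lc) hLc
  exact hS_of_shapes (d := 3) (one_le_of_two_le hLc) hK hδ hE3 hδ₃ W Cw δw hδw hW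

/-- **`hSall` FROM «E3Shape» ∧ «E3Drift» ALONE** (`d = 3`, `Lc ≥ 2`): with the K-slot's two halves from `KSlotAssembly.convCKWall_holds` and
the rates merged at `θ = max θ_K θ₃ ∈ (0, 1)`, the Cauchy S-binder of the wall, together with its rate data `0 ≤ θ < 1`. -/
theorem hSall_of_e3 (hLc : 2 ≤ Lc) {cE cVH cΛ C₃ c₃ θ₃ δ₃ : ℝ}
    (hE3 : ∀ j : ℕ, LocStencil (unitS (sfStep Lc (j + 1)) (smStep 3 Lc (j + 1))
      (fun κ u => (cE * wE 3 Lc (j + 1)) • e3Of 3 Lc cE cVH cΛ (j + 1) κ u)) C₃ δ₃)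
    (hE3d : ∀ k j : ℕ, LocStencil (fun κ u =>
        unitS (sfStep Lc (k + j + 1)) (smStep 3 Lc (k + j + 1))
            (fun κ u => (cE * wE 3 Lc (k + j + 1)) • e3Of 3 Lc cE cVH cΛ (k + j + 1) κ u) κ u -
          unitS (sfStep Lc (k + 1)) (smStep 3 Lc (k + 1))
            (fun κ u => (cE * wE 3 Lc (k + 1)) • e3Of 3 Lc cE cVH cΛ (k + 1) κ u) κ u) (c₃ * θ₃ ^ k) δ₃)
    (hθ₃ : 0 < θ₃) (hθ₃1 : θ₃ < 1) (hδ₃ : 0 < δ₃)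
    (W : ℕ → Fin (3 + 1) → (Fin (3 + 1) → ℤ) → Fin (3 + 1) → (Fin (3 + 1) → ℤ) → MKer (3 + 1) (Fib 3))
    (Cw δw : ℕ → ℝ) (hδw : ∀ j, 0 < δw j) (hW : ∀ j, VertexFamily₂ (W j) Lc (Cw j) (δw j)) :
    ∃ cS θ δS : ℝ, 0 ≤ θ ∧ θ < 1 ∧ 0 < δS ∧ ∀ k j, LocStencil
      (unitS (sfStep Lc (k + j)) (smStep 3 Lc (k + j)) (JsBal0Of (one_le_of_two_le hLc) cE cVH cΛ W Cw δw hδw hW (k + j)).S -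
        unitS (sfStep Lc k) (smStep 3 Lc k) (JsBal0Of (one_le_of_two_le hLc) cE cVH cΛ W Cw δw hδw hW k).S) (cS * θ ^ k) δS := by
  obtain ⟨C, δ, cK, θK, hδ, hθK0, hθK1, hK, hKall⟩ := convCKWall_holds (Lc := Lc) hLc
  -- merge the two rates at θ = max θK θ₃ ∈ (0, 1)
  set θ : ℝ := max θK θ₃ with hθdef
  have hθ0 : 0 < θ := lt_of_lt_of_le hθ₃ (le_max_right _ _)
  have hθ1 : θ < 1 := max_lt hθK1 hθ₃1
  have hKall' : CauchyDecayK 3 Lc (sfStep Lc) (smStep 3 Lc) cK θ δ := cauchyDecayK_mono_theta hKall hθK0 (le_max_left _ _)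
  -- the located drift at the merged rate
  have hc₃ : 0 ≤ c₃ := by
    have h0 := ((hE3d 0 0) 0 0).nonneg (Sum.inl 0)
    simpa using h0
  have hE3d' : ∀ k j : ℕ, LocStencil (fun κ u =>
      unitS (sfStep Lc (k + j + 1)) (smStep 3 Lc (k + j + 1))
          (fun κ u => (cE * wE 3 Lc (k + j + 1)) • e3Of 3 Lc cE cVH cΛ (k + j + 1) κ u) κ u -
        unitS (sfStep Lc (k + 1)) (smStep 3 Lc (k + 1))
          (fun κ u => (cE * wE 3 Lc (k + 1)) • e3Of 3 Lc cE cVH cΛ (k + 1) κ u) κ u) (c₃ * θ ^ k) δ₃ := by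
    intro k j κ u x y a b
    refine ((hE3d k j) κ u x y a b).trans (mul_le_mul_of_nonneg_right ?_ (Real.exp_pos _).le)
    exact mul_le_mul_of_nonneg_left (pow_le_pow_left₀ hθ₃.le (le_max_right _ _) k) hc₃
  obtain ⟨cS, δS, hδS, h⟩ := hSall_of_shapes (d := 3) (one_le_of_two_le hLc) hK hKall' hδ hθ0 hE3 hE3d' hδ₃ W Cw δw hδw hW
  exact ⟨cS, θ, δS, hθ0.le, hθ1, hδS, h⟩

end Summit.QuantumFields.BalabanUV.Beta.GAN24.StencilSlotOfE3

end
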